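import Summits.ResolutionOfSingularities.ResolutionOfSingularities.Theorems.HilbertSamuelEliminationSigmaMaxModificationsCorridor3Directrix214SharpCentre
import Summits.ResolutionOfSingularities.KangarooAtlas.MizutaniVectorGroup
import Literature.AlgebraicGeometry.Resolution.Hironaka1970NearPointNormalConePoint
import HarnessLib

/-!
# [OURS · L1 W4.2] 2.14♯ — both binders from [H4] THEOREM IV and the Hironaka–Grothendieck isomorphism ALONE
# (F-52 and F-50b discharged): `directrix214Sharp_of_thmIV`, `theorem314_geomDir_of_thmIV`

Cell res-hironaka, rung L, slot W4.2 (crux `SigmaMaxModificationsCorridor3`, stmt-ResolutionOfSingularities-19249),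
items T7/T7b. Book-keeping corollaries: with res-D-lib-1's `HironakaScheme.Hironaka1970_thm1_cor_holds` (F-52 PROVED,
`Literature/…/HironakaGroupSchemeAdditiveGenerators.lean`) and the pub-rosobs Mizutani enclosure's
`KangarooAtlas.Mizutani.mizutani1973_vectorGroup_of_dim_le_of_hironaka` (F-50b PROVED from F-52,
`Summits/ResolutionOfSingularities/KangarooAtlas/MizutaniVectorGroup.lean`), and with F-51 reduced to F-51′
(`Hironaka1970_thmIV_point_of_thmIV`), the two directrix binders of the characteristic-2 row rest on the printed
facts F-51′ `Hironaka1970_thmIV` ([H4] Th. IV, general permissible centre), F-split `HerrmannIkedaOrbanz1988_cor_21_11`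
(Hironaka–Grothendieck isomorphism) and `CossartJannsenSaito2020_thm_3_14` (char `0` branch) ONLY:

* `directrix214Sharp_of_thmIV : Hironaka1970_thmIV → Directrix214Sharp` (the point-centre LOCUS clause, T7);
* `theorem314_geomDir_of_thmIV : Hironaka1970_thmIV → HerrmannIkedaOrbanz1988_cor_21_11 → CossartJannsenSaito2020_thm_3_14 →
  Moving.Theorem314_geomDir` (the general-centre numerical binder, T7b).

[OURS · L1 W4.2] new-combination; NOT a statement of any source, and NOT a statement of H. Hironaka's 2017 manuscript.
AI-written (res-type-001 g7); AI review is weaker than expert review.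
-/

set_option linter.dupNamespace false

noncomputable section

open Literature.AlgebraicGeometry.Resolution Literature.AlgebraicGeometry.Resolution.HironakaScheme
open Literature.RingTheory.HilbertSamuel Literature.AlgebraicGeometry.CossartJannsenSaito2020
open Summit.ResolutionOfSingularities.KangarooAtlas.Mizutani

namespace Summit.ResolutionOfSingularities.ResolutionOfSingularities.Theorems.SigmaMaxModificationsCorridor3.Directrix214Sharp

universe u

/-- **2.14♯, point-centre locus clause, from [H4] THEOREM IV alone**: `Directrix214Sharp` (T7, p509064) with F-51
supplied by F-51′ (`Hironaka1970_thmIV_point_of_thmIV`), F-52 by `Hironaka1970_thm1_cor_holds` and F-50b by the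
Mizutani enclosure's `mizutani1973_vectorGroup_of_dim_le_of_hironaka`. [OURS · L1 W4.2; AI-written] -/
theorem directrix214Sharp_of_thmIV (h51 : Hironaka1970_thmIV.{u}) : Directrix214Sharp.{u} :=
  directrix_nearPoint_of_geomDirDim_le (Hironaka1970_thmIV_point_of_thmIV h51) Hironaka1970_thm1_cor_holds
    fun p _ => mizutani1973_vectorGroup_of_dim_le_of_hironaka p (Hironaka1970_thm1_cor_holds p)

/-- **2.14♯, general-centre numerical binder, from [H4] THEOREM IV, the Hironaka–Grothendieck isomorphism and CJS
Thm. 3.14 (char `0`) alone**: `Moving.Theorem314_geomDir` via `theorem314_geomDir_of_facts_of_mizutani` (T7b, p516811)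
with F-50b supplied by the Mizutani enclosure. [OURS · L1 W4.2; AI-written] -/
theorem theorem314_geomDir_of_thmIV (h51 : Hironaka1970_thmIV.{u}) (hsplit : HerrmannIkedaOrbanz1988_cor_21_11.{u})
    (h314 : CossartJannsenSaito2020_thm_3_14.{u}) : Moving.Theorem314_geomDir.{u} :=
  theorem314_geomDir_of_facts_of_mizutani h51
    (fun p _ => mizutani1973_vectorGroup_of_dim_le_of_hironaka p (Hironaka1970_thm1_cor_holds p)) hsplit h314

end Summit.ResolutionOfSingularities.ResolutionOfSingularities.Theorems.SigmaMaxModificationsCorridor3.Directrix214Sharp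

end
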